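/-
Copyright (c) 2026 the pub-hodgecm-mathlib formalisation cell (harness21).  Prover seat hodgecm-mathlib-A-p19 (g20), topic T5 = P8
«(C♯)hol interior», node C∞ brick (WT) «the Weil torus at the place of `ι`: the projected theta class of a Hermite box vector is an
EIGENVECTOR of the diagonal torus, with explicit integer exponents» (desk F0P2-plan (g9) 23:23Z).  KERNEL: theorems only.
-/
import Literature.NumberTheory.GelbartRogawski1991.DoubledWeilRepresentationArchPlaceVacuumBlock
import Literature.NumberTheory.GelbartRogawski1991.DoubledWeilRepresentationArchPlaceHermite
import Literature.NumberTheory.Automorphic.Liu2021.Def411WeilCarriersArchPlaceOperator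
import Literature.NumberTheory.Automorphic.Liu2021.ThetaLiftFromLineEquivariantFunctional
import Literature.NumberTheory.Automorphic.Liu2021.ThetaLiftFromLineFrameArchProj
import Literature.NumberTheory.Automorphic.Liu2021.ThetaLiftFromLineCoinvariantJunction
import Literature.Analysis.SegalBargmann.FockCompactDiagonal
import HarnessLib

/-!
# Node C∞, the Weil torus: `ω((diag s at w(ι)), 1) E(h^V_β ⊗ Φ_f) = (∏_p s_p^{n_p(β)}) • E(h^V_β ⊗ Φ_f)` with
# `n_p = (τ_w+1)/2 + β_p` on the positive sign class and `(τ_w−1)/2 − β_p` on the negative one ([KonnoKonno2007, Thm. 5.4, Lem. 5.2]; [Folland1989, Prop. (4.39)])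

Topic `NumberTheory/Automorphic/Liu2021` (cell hodgecm-mathlib, T5 = P8 «(C♯)hol interior», node C∞ = [Liu2021, Lem. D.2 (2)] at the place of `ι`); namespace
`Literature.NumberTheory.Automorphic.Liu2021.CinfThetaTorus`.  KERNEL ONLY: proved theorems; 0 definitions, 0 records, 0 `sorry`.

Assembles, for the DIAGONAL torus `u_s = diag(s)` of `U(σ_{w(v₀)} diag dV)(ℂ)` at an arbitrary (in node C∞: the indefinite) real place `v₀`:
* §1 the torus elements (`exists_archLocal_coe_eq_diagonal`), their scaled-frame matrix `R = diag(s ∘ p)` (`p(k) = (e⁻¹ k).1`), the block hypothesis of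
  ★ (W1)/(W2), the EXPLICIT unitary `W_s = diag(w)`, `w_k = s̄_{p(k)}` on the positive sign class, `s_{p(k)}` on the negative one (★ (W1)
  `exists_sectionD_archKPlace_apply_of_blockDiag`), `vac = (∏_{neg k} s_{p(k)})⁻¹` (★ (W2)), `η_τ = (∏ s)^{M(τ_w+1)/2}` (★ `coe_etaD_archKPlace`);
* §2 `unitaryOpPi_placeBlock_mulSingle_diagonal_hermitePi` — a diagonal unitary at one place acts on the Hermite function `h_β` by the character
  `∏_k w̄_k^{β(k,v₀)}` (★ `unitaryOpPi_binvPi`, ★ `fockLinSubst_diagonal_monomial`: `μ₀(U) B⁻¹F = B⁻¹(F ∘ Ū)`);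
* §3 the box identity `hS` of ★ T2 for `u_s` on `h^V_β ⊠ h^V_0` with `a₁′ = a₁` and `c = vac · ∏_k w̄_k^{β(k,v₀)}` (★ β-II
  `carrierConjEquiv_frameD_placeBlock_mulSingle_doubled_archBoxTensor`), hence ★ T2: **`pairRep_chiSplittingLine_adelicSingle_diagonal_follandHermite_tmul`** —
  `ω((u_s at w(v₀)), 1) E(h^V_β ⊗ Φ_f) = (η_τ(u_s) · vac · ∏ w̄^β) • E(h^V_β ⊗ Φ_f)`;
* §4 the EXPONENT NORMAL FORM on the line datum of node C∞ (`N = 3`, `M = 1`, `dW = ⟨a⟩`): the scalar is `∏_{p : Fin 3} (s p)^{n p}` with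
  `n p = (τ_w+1)/2 + β(e₁(p,0), v₀)` if `0 < x_{v₀}(e₁(p,0))` and `n p = (τ_w−1)/2 − β(e₁(p,0), v₀)` otherwise (`|s_p| = 1`);
* §5 with ★ FILE 1 `exists_arch_starProjection_toLp_lineThetaLift_pairRep_adelicSingle` and ★ (P2) `exists_cmArchSection_mul_eq_of_adelicSingle_placeOf`:
  **`exists_U21_smul_starProjection_toLp_lineThetaLift_follandHermite`** — at the place of `ι`, for every unit `s : Fin 3 → ℂ` and every `β`, `Φ_f`:
  `∃ U ∈ U(2,1), k ∈ K_c`, `U = T⁻¹ ι(g) diag(embTwist ι ∘ s) ι(g)⁻¹ T` and `(∏_p s_p^{n_p}) • pr_P [Θ̃_{E(h^V_β ⊗ Φ_f)}(f) ∘ ιA] = R(cmArchSection U) (R(k) pr_P [Θ̃_{E(h^V_β ⊗ Φ_f)}(f) ∘ ιA])`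
  — the theta side of the integer equations of node C∞ (P2 bus 2026-08-31T23:27Z; ref1 r211).

HONEST SCOPE.  The letter ★ `Liu2021.meetsThetaLiftFromLine_hol_archTypeAt` is NOT proved here (this is the Weil-side input of its closer); HC_CM is NOT proved
here or anywhere in the tree.  References: [KonnoKonno2007] Thm. 5.4, Lem. 5.2; [Folland1989] §1.7, Prop. (4.39); [Liu2021] App. D Lem. D.2 (2),
proof of Prop. 4.13 Case 1 (l. 2137–2141); [BorelJacquet1979] §4.1, §4.6.
-/

set_option autoImplicit false

noncomputable section

open NumberField NumberField.InfinitePlace MeasureTheory IsDedekindDomain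
open scoped Matrix ComplexOrder ENNReal TensorProduct SchwartzMap Kronecker Classical ComplexConjugate

namespace Literature.NumberTheory.Automorphic.Liu2021.CinfThetaTorus

open _root_.MeasureTheory
open Literature.NumberTheory.Automorphic Literature.NumberTheory.Automorphic.UnitaryGroup
open Literature.NumberTheory.Automorphic.UnitaryGroup.CotangentForms
open Literature.NumberTheory.Automorphic.IdeleClassGroup
open Literature.NumberTheory.Automorphic.Liu2021
open Literature.NumberTheory.Automorphic.Liu2021.Def411WeilCarriers
open Literature.NumberTheory.Automorphic.Liu2021.Def411WeilCarriersDoubling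
open Literature.NumberTheory.GelbartRogawski1991 Literature.NumberTheory.GelbartRogawski1991.UnitaryDualPair
open Literature.NumberTheory.GelbartRogawski1991.GRConstruction
open Literature.NumberTheory.Weil1964
open Literature.RepresentationTheory.Liu2021
open Literature.RepresentationTheory.HeisenbergGroup Literature.Analysis.SegalBargmann
open Literature.RepresentationTheory.KonnoKonno2007 Literature.RepresentationTheory.KonnoKonno2007.RealDualPair

/-! ## §1 The diagonal torus of `U(σ_w diag dV)(ℂ)` and its scaled frame -/

section Torus

variable (L : Type) [Field L] [NumberField L] [IsCMField L] {N M n : ℕ} (e : Fin N × Fin M ≃ Fin n)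
  (dV : Fin N → L) (hdV : ∀ i, IsCMField.complexConj L (dV i) = dV i) (hdV0 : ∀ i, dV i ≠ 0)
  (dW : Fin M → L) (hdW : ∀ i, IsCMField.complexConj L (dW i) = dW i) (hdW0 : ∀ i, dW i ≠ 0)
  (v₀ : {v : InfinitePlace (Fp L) // v.IsReal})

omit [NumberField L] [IsCMField L] in
/-- **the diagonal unitaries lie in `U(σ_w diag dV)(ℂ)`**: for `star s · s = 1` there is `u` with matrix `diagonal s` (diagonal matrices commute with the
diagonal form). [cite: KonnoKonno2007, §3.1 (3.1)] -/
theorem exists_archLocal_coe_eq_diagonal (w : {w : InfinitePlace L // w.IsComplex}) (s : Fin N → ℂ) (hs : ∀ p, star (s p) * s p = 1) :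
    ∃ u : UnitaryGroup.archLocal L N (Matrix.diagonal dV) w,
      (((u : UnitaryGroup.archLocal L N (Matrix.diagonal dV) w) : GL (Fin N) ℂ) : Matrix (Fin N) (Fin N) ℂ) = Matrix.diagonal s := by
  have hs0 : ∀ p, s p ≠ 0 := fun p h => by have := hs p; rw [h, mul_zero] at this; exact zero_ne_one this
  have hdet : (Matrix.diagonal s).det ≠ 0 := by rw [Matrix.det_diagonal]; exact Finset.prod_ne_zero_iff.2 fun p _ => hs0 p
  have hmem : (Matrix.diagonal s)ᴴ * (Matrix.diagonal dV).map w.1.embedding * Matrix.diagonal s = (Matrix.diagonal dV).map w.1.embedding := by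
    rw [Matrix.diagonal_map (map_zero _), Matrix.diagonal_conjTranspose, Matrix.diagonal_mul_diagonal, Matrix.diagonal_mul_diagonal]
    congr 1
    funext p
    rw [Pi.star_apply, mul_comm (star (s p)), mul_assoc, hs p, mul_one]
  refine ⟨⟨Matrix.GeneralLinearGroup.mkOfDetNeZero _ hdet, ?_⟩, ?_⟩
  · rw [UnitaryGroup.mem_archLocal_iff_conjTranspose, Matrix.GeneralLinearGroup.val_mkOfDetNeZero]
    exact hmem
  · rw [Matrix.GeneralLinearGroup.val_mkOfDetNeZero]

/-- the scaled-frame matrix of a diagonal `u` is diagonal: `e-reindex (diag s ⊗ 1_W) = diagonal (s ∘ p)`, `p(k) = (e⁻¹ k).1`. [folklore] -/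
private theorem reindex_diagonal_kronecker_one (s : Fin N → ℂ) :
    Matrix.reindex e e (Matrix.diagonal s ⊗ₖ (1 : Matrix (Fin M) (Fin M) ℂ)) = Matrix.diagonal fun k => s (e.symm k).1 := by
  rw [← Matrix.diagonal_one, Matrix.diagonal_kronecker_diagonal, Matrix.reindex_apply, Matrix.submatrix_diagonal_equiv]
  congr 1
  funext k
  simp only [Function.comp_apply, mul_one]

/-- a diagonal `u` is sign-block-diagonal (the hypothesis `hblk` of ★ (W1)/(W2)). [folklore] -/
private theorem hblk_of_diagonal (u : UnitaryGroup.archLocal L N (Matrix.diagonal dV) (cmPlaceOver L v₀)) (s : Fin N → ℂ)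
    (hu : (((u : UnitaryGroup.archLocal L N (Matrix.diagonal dV) (cmPlaceOver L v₀)) : GL (Fin N) ℂ) : Matrix (Fin N) (Fin N) ℂ) = Matrix.diagonal s) :
    ∀ k k' : Fin n, 0 < signVec (cmPlaceOver L) (cmGramEntry L e dV hdV dW hdW) (imagUnit L) v₀ k →
      ¬ 0 < signVec (cmPlaceOver L) (cmGramEntry L e dV hdV dW hdW) (imagUnit L) v₀ k' →
      Matrix.reindex e e
          ((((u : UnitaryGroup.archLocal L N (Matrix.diagonal dV) (cmPlaceOver L v₀)) : GL (Fin N) ℂ) : Matrix (Fin N) (Fin N) ℂ) ⊗ₖ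
            (1 : Matrix (Fin M) (Fin M) ℂ)) k k' = 0 ∧
      Matrix.reindex e e
          ((((u : UnitaryGroup.archLocal L N (Matrix.diagonal dV) (cmPlaceOver L v₀)) : GL (Fin N) ℂ) : Matrix (Fin N) (Fin N) ℂ) ⊗ₖ
            (1 : Matrix (Fin M) (Fin M) ℂ)) k' k = 0 := by
  intro k k' hk hk'
  have hne : k ≠ k' := fun h => hk' (h ▸ hk)
  rw [hu, reindex_diagonal_kronecker_one]
  exact ⟨Matrix.diagonal_apply_ne _ hne, Matrix.diagonal_apply_ne _ (Ne.symm hne)⟩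

include hdV0 hdW0 in
/-- **Folland's section at the diagonal torus element**: `sectionD k_{v₀,u_s} f = vac • μ₀(placeBlock (δ_{v₀} ↦ ((diag w) ⊕ 1)^{e₂⁻¹})) f` with the EXPLICIT
diagonal `w_k = s̄_{p(k)}` for `0 < x_{v₀,k}` and `w_k = s_{p(k)}` otherwise (★ (W1) with `R = diag(s ∘ p)`: the scaling `D_k D_k⁻¹` cancels).
[cite: Folland1989, §4.2 Prop. (4.39)] [cite: KonnoKonno2007, Lem. 5.2] -/
theorem exists_sectionD_archKPlace_apply_of_diagonal (u : UnitaryGroup.archLocal L N (Matrix.diagonal dV) (cmPlaceOver L v₀)) (s : Fin N → ℂ)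
    (hu : (((u : UnitaryGroup.archLocal L N (Matrix.diagonal dV) (cmPlaceOver L v₀)) : GL (Fin N) ℂ) : Matrix (Fin N) (Fin N) ℂ) = Matrix.diagonal s) :
    ∃ W : Matrix.unitaryGroup (Fin n) ℂ,
      (W : Matrix (Fin n) (Fin n) ℂ) = Matrix.diagonal (fun k => if 0 < signVec (cmPlaceOver L) (cmGramEntry L e dV hdV dW hdW) (imagUnit L) v₀ k
        then star (s (e.symm k).1) else s (e.symm k).1) ∧
      ∀ f : SchwartzMap ((Fin (n + n) × {v : InfinitePlace (Fp L) // v.IsReal}) → ℝ) ℂ,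
        (sectionD L e dV hdV hdV0 dW hdW hdW0 (archKPlace L e dV hdV dW hdW v₀ u)).1.2 f =
          MpS.vac (sectionD L e dV hdV hdV0 dW hdW hdW0 (archKPlace L e dV hdV dW hdW v₀ u)) •
            unitaryOpPi (placeBlock (Pi.mulSingle v₀ (reindexUnitary (e₂ (n := n)).symm (blockU (W, 1))))) f := by
  have hblk := hblk_of_diagonal L e dV hdV dW hdW v₀ u s hu
  obtain ⟨W, hW, hop⟩ := exists_sectionD_archKPlace_apply_of_blockDiag L e dV hdV hdV0 dW hdW hdW0 v₀ u hblk
  refine ⟨W, Matrix.ext fun i i' => ?_, hop⟩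
  have hD0 : (((sqrtAbs (signVec (cmPlaceOver L) (cmGramEntry L e dV hdV dW hdW) (imagUnit L) v₀) i : ℝ) : ℂ)) ≠ 0 :=
    Complex.ofReal_ne_zero.mpr (sqrtAbs_signVec_ne_zero (IsCMField.complexConj_ne_one L) (cmPlaceOver_smul L)
      (complexConj_imagUnit L) (imagUnit_ne_zero L) (cmGramEntry_ne_zero L e dV hdV dW hdW hdV0 hdW0) v₀ i)
  rw [hW, hu, reindex_diagonal_kronecker_one]
  by_cases hii : i = i'
  · subst hii
    rw [Matrix.diagonal_apply_eq, Matrix.diagonal_apply_eq,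
      mul_comm ((((sqrtAbs (signVec (cmPlaceOver L) (cmGramEntry L e dV hdV dW hdW) (imagUnit L) v₀) i : ℝ) : ℂ))) (s (e.symm i).1),
      mul_inv_cancel_right₀ hD0]
  · rw [Matrix.diagonal_apply_ne _ hii, Matrix.diagonal_apply_ne _ hii, mul_zero, zero_mul, star_zero]
    split_ifs <;> rfl

include hdV0 hdW0 in
set_option maxHeartbeats 800000 in
/-- **the vacuum coefficient at the diagonal torus element**: `vac (sectionD k_{v₀,u_s}) = (∏_{k ∈ NegIdx x_{v₀}} s_{p(k)})⁻¹` (★ (W2)).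
[cite: Folland1989, §4.2 Prop. (4.39)] [cite: KonnoKonno2007, Lem. 5.2] -/
theorem vac_sectionD_archKPlace_of_diagonal (u : UnitaryGroup.archLocal L N (Matrix.diagonal dV) (cmPlaceOver L v₀)) (s : Fin N → ℂ)
    (hu : (((u : UnitaryGroup.archLocal L N (Matrix.diagonal dV) (cmPlaceOver L v₀)) : GL (Fin N) ℂ) : Matrix (Fin N) (Fin N) ℂ) = Matrix.diagonal s) :
    MpS.vac (sectionD L e dV hdV hdV0 dW hdW hdW0 (archKPlace L e dV hdV dW hdW v₀ u)) =
      (∏ q : NegIdx (signVec (cmPlaceOver L) (cmGramEntry L e dV hdV dW hdW) (imagUnit L) v₀), s (e.symm q.1).1)⁻¹ := by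
  have hblk := hblk_of_diagonal L e dV hdV dW hdW v₀ u s hu
  rw [vac_sectionD_archKPlace_of_blockDiag L e dV hdV hdV0 dW hdW hdW0 v₀ u hblk]
  congr 1
  rw [hu, reindex_diagonal_kronecker_one]
  have hsub : (Matrix.diagonal fun k => s (e.symm k).1).submatrix
      (fun q : NegIdx (signVec (cmPlaceOver L) (cmGramEntry L e dV hdV dW hdW) (imagUnit L) v₀) => q.1)
      (fun q : NegIdx (signVec (cmPlaceOver L) (cmGramEntry L e dV hdV dW hdW) (imagUnit L) v₀) => q.1) =
      Matrix.diagonal (fun q : NegIdx (signVec (cmPlaceOver L) (cmGramEntry L e dV hdV dW hdW) (imagUnit L) v₀) => s (e.symm q.1).1) := by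
    ext q q'
    by_cases hq : q = q'
    · subst hq
      rw [Matrix.submatrix_apply, Matrix.diagonal_apply_eq, Matrix.diagonal_apply_eq]
    · have hq' : q.1 ≠ q'.1 := fun h => hq (Subtype.ext h)
      rw [Matrix.submatrix_apply, Matrix.diagonal_apply_ne _ hq', Matrix.diagonal_apply_ne _ hq]
  rw [hsub, Matrix.det_diagonal]

/-- **the twist character at the diagonal torus element**: `η_τ(k_{v₀,u_s}) = ((∏ s)^M)^{(τ_w+1)/2}` (★ `coe_etaD_archKPlace`).
[cite: KonnoKonno2007, Lem. 5.2] -/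
theorem coe_etaD_archKPlace_of_diagonal (τ : InfinitePlace L → ℤ) (u : UnitaryGroup.archLocal L N (Matrix.diagonal dV) (cmPlaceOver L v₀))
    (s : Fin N → ℂ)
    (hu : (((u : UnitaryGroup.archLocal L N (Matrix.diagonal dV) (cmPlaceOver L v₀)) : GL (Fin N) ℂ) : Matrix (Fin N) (Fin N) ℂ) = Matrix.diagonal s) :
    ((etaD L e dV hdV dW hdW τ (archKPlace L e dV hdV dW hdW v₀ u) : ℂˣ) : ℂ) = ((∏ p, s p) ^ M) ^ ((τ (cmPlaceOver L v₀).1 + 1) / 2) := by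
  rw [coe_etaD_archKPlace, hu, Matrix.det_diagonal]

end Torus

/-! ## §2 A diagonal unitary at one place acts on the Hermite functions by a character -/

section Hermite

variable {ι o : Type} [Fintype ι] [DecidableEq ι] [Fintype o] [DecidableEq o]

/-- **`μ₀(placeBlock (δ_{v₀} ↦ diag w)) h_β = (∏_k w̄_k^{β(k,v₀)}) • h_β`**: a diagonal unitary at ONE place acts on the Hermite function `h_β = B⁻¹ζ_β` by the
monomial character (★ `unitaryOpPi_binvPi`: `μ₀(U) B⁻¹F = B⁻¹(F ∘ Ū)`; ★ `fockLinSubst_diagonal_monomial`). [cite: Folland1989, §1.7, §4.2 Prop. (4.39)] -/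
theorem unitaryOpPi_placeBlock_mulSingle_diagonal_hermitePi (v₀ : o) (W : Matrix.unitaryGroup ι ℂ) (w : ι → ℂ)
    (hW : (W : Matrix ι ι ℂ) = Matrix.diagonal w) (β : (ι × o) →₀ ℕ) :
    unitaryOpPi (placeBlock (Pi.mulSingle v₀ W)) (hermitePi β) = (∏ k, star (w k) ^ β (k, v₀)) • (hermitePi β : SchwartzMap ((ι × o) → ℝ) ℂ) := by
  -- the adjoint of the place block is the diagonal matrix `diag(d)`, `d (k,v) = w̄_k` at `v₀`, `1` elsewhere
  set d : ι × o → ℂ := fun kv => if kv.2 = v₀ then star (w kv.1) else 1 with hd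
  have hstar : star ((placeBlock (Pi.mulSingle v₀ W) : Matrix.unitaryGroup (ι × o) ℂ) : Matrix (ι × o) (ι × o) ℂ) = Matrix.diagonal d := by
    rw [star_coe_placeBlock_mulSingle, hW, Matrix.star_eq_conjTranspose, Matrix.diagonal_conjTranspose]
    have h1 : (Pi.mulSingle v₀ (Matrix.diagonal (star w)) : o → Matrix ι ι ℂ) = fun v => Matrix.diagonal (fun k => d (k, v)) := by
      funext v
      by_cases hv : v = v₀
      · subst hv
        rw [Pi.mulSingle_eq_same]
        congr 1; funext k; rw [hd]; simp
      · rw [Pi.mulSingle_eq_of_ne hv, ← Matrix.diagonal_one]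
        congr 1; funext k; rw [hd]; simp [hv]
    rw [h1, Matrix.blockDiagonal_diagonal]
  rw [← binvPi_zeta, unitaryOpPi_binvPi, hstar, zeta, map_smul, fockLinSubst_diagonal_monomial, MvPolynomial.C_mul', ← smul_assoc,
    smul_eq_mul, mul_comm, ← smul_eq_mul, smul_assoc, binvPi_smul]
  congr 1
  -- `∏_{(k,v)} d(k,v)^{β(k,v)} = ∏_k w̄_k^{β(k,v₀)}`
  rw [Fintype.prod_prod_type]
  refine Finset.prod_congr rfl fun k _ => ?_
  rw [Finset.prod_eq_single v₀ (fun v _ hv => by rw [hd]; simp [hv]) (fun h => absurd (Finset.mem_univ v₀) h), hd]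
  simp

end Hermite

/-! ## §3 The box identity and the eigen-identity of the Weil representation on `E(h^V_β ⊗ Φ_f)` -/

section Box

variable (L : Type) [Field L] [NumberField L] [IsCMField L] {N M n : ℕ} (e : Fin N × Fin M ≃ Fin n)
  (dV : Fin N → L) (hdV : ∀ i, IsCMField.complexConj L (dV i) = dV i) (hdV0 : ∀ i, dV i ≠ 0)
  (dW : Fin M → L) (hdW : ∀ i, IsCMField.complexConj L (dW i) = dW i) (hdW0 : ∀ i, dW i ≠ 0)
  (v₀ : {v : InfinitePlace (Fp L) // v.IsReal})

omit [IsCMField L] in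
/-- homogeneity of `archBoxTensor` in the first slot. [folklore] -/
private theorem archBoxTensor_smul_left {ι₁ ι₂ : Type} [Fintype ι₁] [Fintype ι₂] (c : ℂ)
    (f : 𝓢((ι₁ → mixedEmbedding.mixedSpace (Fp L)), ℂ)) (g : 𝓢((ι₂ → mixedEmbedding.mixedSpace (Fp L)), ℂ)) :
    archBoxTensor (c • f) g = c • archBoxTensor f g := by
  ext x
  simp only [archBoxTensor_apply, _root_.smul_apply, smul_eq_mul, mul_assoc]

include hdV0 hdW0 in
set_option maxHeartbeats 800000 in
/-- **THE BOX IDENTITY AT THE DIAGONAL TORUS ELEMENT**: `frameD^* sectionD(k_{v₀,u_s}) (frameD^*)⁻¹ (R_{e₂}(h^V_β ⊠ h^V_0)) = (vac · ∏_k w̄_k^{β(k,v₀)}) • R_{e₂}(h^V_β ⊠ h^V_0)`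
— the Hermite box vectors are EIGENVECTORS (★ §1 + ★ β-II + §2). [cite: Folland1989, §4.2 Prop. (4.39)] [cite: KonnoKonno2007, Lem. 5.2, Thm. 5.4] -/
theorem carrierConjEquiv_frameD_sectionD_archKPlace_of_diagonal (u : UnitaryGroup.archLocal L N (Matrix.diagonal dV) (cmPlaceOver L v₀))
    (s : Fin N → ℂ)
    (hu : (((u : UnitaryGroup.archLocal L N (Matrix.diagonal dV) (cmPlaceOver L v₀)) : GL (Fin N) ℂ) : Matrix (Fin N) (Fin N) ℂ) = Matrix.diagonal s)
    (β : (Fin n × {v : InfinitePlace (Fp L) // v.IsReal}) →₀ ℕ) :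
    carrierConjEquiv (frameD L e dV hdV hdV0 dW hdW hdW0) (sectionD L e dV hdV hdV0 dW hdW hdW0 (archKPlace L e dV hdV dW hdW v₀ u)).1.2
        (schwartzReindexCLM (Fp L) (e₂ (n := n))
          (archBoxTensor (follandHermite (frameV L e dV hdV hdV0 dW hdW hdW0) β) (follandHermite (frameV L e dV hdV hdV0 dW hdW hdW0) 0))) =
      (MpS.vac (sectionD L e dV hdV hdV0 dW hdW hdW0 (archKPlace L e dV hdV dW hdW v₀ u)) *
          ∏ k, star (if 0 < signVec (cmPlaceOver L) (cmGramEntry L e dV hdV dW hdW) (imagUnit L) v₀ k then star (s (e.symm k).1) else s (e.symm k).1) ^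
            β (k, v₀)) •
        schwartzReindexCLM (Fp L) (e₂ (n := n))
          (archBoxTensor (follandHermite (frameV L e dV hdV hdV0 dW hdW hdW0) β) (follandHermite (frameV L e dV hdV hdV0 dW hdW hdW0) 0)) := by
  obtain ⟨W, hW, hop⟩ := exists_sectionD_archKPlace_apply_of_diagonal L e dV hdV hdV0 dW hdW hdW0 v₀ u s hu
  have hdiag : carrierConjEquiv (frameV L e dV hdV hdV0 dW hdW hdW0) (unitaryEquivPi (placeBlock (Pi.mulSingle v₀ W)))
      (follandHermite (frameV L e dV hdV hdV0 dW hdW hdW0) β) =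
      (∏ k, star (if 0 < signVec (cmPlaceOver L) (cmGramEntry L e dV hdV dW hdW) (imagUnit L) v₀ k then star (s (e.symm k).1) else s (e.symm k).1) ^
          β (k, v₀)) • follandHermite (frameV L e dV hdV hdV0 dW hdW hdW0) β := by
    rw [carrierConjEquiv_apply, follandHermite, ContinuousLinearEquiv.apply_symm_apply, unitaryEquivPi_apply,
      unitaryOpPi_placeBlock_mulSingle_diagonal_hermitePi v₀ W _ hW β, map_smul]
  have hβII := carrierConjEquiv_frameD_placeBlock_mulSingle_doubled_archBoxTensor L e dV hdV hdV0 dW hdW hdW0 W v₀ β 0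
  rw [carrierConjEquiv_apply, unitaryEquivPi_apply] at hβII
  rw [carrierConjEquiv_apply, hop, map_smul, hβII, hdiag, archBoxTensor_smul_left, map_smul, smul_smul]

end Box

/-! ## §4 The line datum of node C∞: the exponent normal form `∏_p (s p)^{n p}` -/

section Line

variable (L : Type) [Field L] [NumberField L] [IsCMField L] {n' : ℕ} (e₁ : Fin 3 × Fin 1 ≃ Fin n') (dV : Fin 3 → L)
  (hdV : ∀ i, IsCMField.complexConj L (dV i) = dV i) (hdV0 : ∀ i, dV i ≠ 0)
  (μ : Literature.NumberTheory.Automorphic.IdeleClassGroup L →ₜ* Circle) (hμ : IsConjugateSymplectic L μ) (a : (↥(maximalRealSubfield L))ˣ)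
  (v₀ : {v : InfinitePlace (Fp L) // v.IsReal})

/-- `k ↦ (e₁⁻¹ k).1` and `p ↦ e₁ (p, 0)` are inverse bijections `Fin n' ≃ Fin 3` (`Fin 1` is a point). [folklore] -/
private theorem e₁_symm_fst_apply (p : Fin 3) : (e₁.symm (e₁ (p, 0))).1 = p := by rw [Equiv.symm_apply_apply]

/-- reindexing a product over `Fin n'` along `k = e₁(p, 0)`. [folklore] -/
private theorem prod_fin_eq_prod_fin_three (f : Fin n' → ℂ) : ∏ k, f k = ∏ p : Fin 3, f (e₁ (p, 0)) := by
  rw [Fintype.prod_equiv e₁.symm f (fun pq => f (e₁ pq)) (fun k => by rw [Equiv.apply_symm_apply]), Fintype.prod_prod_type]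
  refine Finset.prod_congr rfl fun p _ => ?_
  rw [Fin.prod_univ_one]

include hdV0 in
/-- **THE EXPONENT NORMAL FORM**: on the line datum (`dW = ⟨a⟩`), for unit `s`, the scalar `η_τ(k_{v₀,u_s}) · (vac · ∏_k w̄_k^{β(k,v₀)})` equals
`∏_{p : Fin 3} (s p)^{n p}` with `n p = (τ_w+1)/2 + β(e₁(p,0),v₀)` on the positive sign class and `(τ_w+1)/2 − 1 − β(e₁(p,0),v₀)` on the negative one.
[cite: KonnoKonno2007, Thm. 5.4, Lem. 5.2] -/
theorem etaD_mul_vac_mul_prod_of_diagonal (τ : InfinitePlace L → ℤ)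
    (u : UnitaryGroup.archLocal L 3 (Matrix.diagonal dV) (cmPlaceOver L v₀)) (s : Fin 3 → ℂ) (hs : ∀ p, star (s p) * s p = 1)
    (hu : (((u : UnitaryGroup.archLocal L 3 (Matrix.diagonal dV) (cmPlaceOver L v₀)) : GL (Fin 3) ℂ) : Matrix (Fin 3) (Fin 3) ℂ) = Matrix.diagonal s)
    (β : (Fin n' × {v : InfinitePlace (Fp L) // v.IsReal}) →₀ ℕ) :
    ((etaD L e₁ dV hdV (lineW L (TW (Fp L) a)) (complexConj_lineW L (TW (Fp L) a)) τ
        (archKPlace L e₁ dV hdV (lineW L (TW (Fp L) a)) (complexConj_lineW L (TW (Fp L) a)) v₀ u) : ℂˣ) : ℂ) *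
      (MpS.vac (sectionD L e₁ dV hdV hdV0 (lineW L (TW (Fp L) a)) (complexConj_lineW L (TW (Fp L) a))
          (lineW_ne_zero L (TW (Fp L) a) (isUnit_det_TW (Fp L) a))
          (archKPlace L e₁ dV hdV (lineW L (TW (Fp L) a)) (complexConj_lineW L (TW (Fp L) a)) v₀ u)) *
        ∏ k, star (if 0 < signVec (cmPlaceOver L) (cmGramEntry L e₁ dV hdV (lineW L (TW (Fp L) a)) (complexConj_lineW L (TW (Fp L) a))) (imagUnit L) v₀ k
          then star (s (e₁.symm k).1) else s (e₁.symm k).1) ^ β (k, v₀)) =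
      ∏ p : Fin 3, s p ^ (if 0 < signVec (cmPlaceOver L) (cmGramEntry L e₁ dV hdV (lineW L (TW (Fp L) a)) (complexConj_lineW L (TW (Fp L) a))) (imagUnit L) v₀ (e₁ (p, 0))
        then (τ (cmPlaceOver L v₀).1 + 1) / 2 + β (e₁ (p, 0), v₀)
        else (τ (cmPlaceOver L v₀).1 + 1) / 2 - 1 - β (e₁ (p, 0), v₀)) := by
  have hs0 : ∀ p, s p ≠ 0 := fun p h => by have := hs p; rw [h, mul_zero] at this; exact zero_ne_one this
  have hsinv : ∀ p, star (s p) = (s p)⁻¹ := fun p => eq_inv_of_mul_eq_one_left (hs p)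
  rw [coe_etaD_archKPlace_of_diagonal L e₁ dV hdV (lineW L (TW (Fp L) a)) (complexConj_lineW L (TW (Fp L) a)) v₀ τ u s hu,
    vac_sectionD_archKPlace_of_diagonal L e₁ dV hdV hdV0 (lineW L (TW (Fp L) a)) (complexConj_lineW L (TW (Fp L) a))
      (lineW_ne_zero L (TW (Fp L) a) (isUnit_det_TW (Fp L) a)) v₀ u s hu, pow_one]
  -- everything as products over `p : Fin 3` of integer powers of `s p`
  set c : ℤ := (τ (cmPlaceOver L v₀).1 + 1) / 2 with hc
  set P : Fin 3 → Prop := fun p => 0 < signVec (cmPlaceOver L) (cmGramEntry L e₁ dV hdV (lineW L (TW (Fp L) a)) (complexConj_lineW L (TW (Fp L) a)))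
    (imagUnit L) v₀ (e₁ (p, 0)) with hP
  -- (b) the vacuum: `(∏_{neg k} s)⁻¹ = ∏_p (if P p then 1 else (s p)⁻¹)`
  have hb : (∏ q : NegIdx (signVec (cmPlaceOver L) (cmGramEntry L e₁ dV hdV (lineW L (TW (Fp L) a)) (complexConj_lineW L (TW (Fp L) a))) (imagUnit L) v₀),
      s (e₁.symm q.1).1)⁻¹ = ∏ p : Fin 3, (if P p then 1 else s p ^ (-1 : ℤ)) := by
    rw [← Finset.prod_inv_distrib]
    have h1 : ∏ q : NegIdx (signVec (cmPlaceOver L) (cmGramEntry L e₁ dV hdV (lineW L (TW (Fp L) a)) (complexConj_lineW L (TW (Fp L) a))) (imagUnit L) v₀),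
        (s (e₁.symm q.1).1)⁻¹ =
        ∏ k : Fin n', (if 0 < signVec (cmPlaceOver L) (cmGramEntry L e₁ dV hdV (lineW L (TW (Fp L) a)) (complexConj_lineW L (TW (Fp L) a))) (imagUnit L) v₀ k
          then 1 else (s (e₁.symm k).1)⁻¹) := by
      rw [← Finset.prod_subtype (Finset.univ.filter fun k => ¬ 0 < signVec (cmPlaceOver L)
        (cmGramEntry L e₁ dV hdV (lineW L (TW (Fp L) a)) (complexConj_lineW L (TW (Fp L) a))) (imagUnit L) v₀ k)
        (by intro k; simp) (fun k => (s (e₁.symm k).1)⁻¹), Finset.prod_filter]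
      refine Finset.prod_congr rfl fun k _ => ?_
      split_ifs <;> rfl
    rw [h1, prod_fin_eq_prod_fin_three e₁]
    refine Finset.prod_congr rfl fun p _ => ?_
    rw [e₁_symm_fst_apply, zpow_neg, zpow_one]
  -- (c) the character: `∏_k w̄^β = ∏_p (if P p then s^β else s^{-β})`
  have hc' : ∏ k, star (if 0 < signVec (cmPlaceOver L) (cmGramEntry L e₁ dV hdV (lineW L (TW (Fp L) a)) (complexConj_lineW L (TW (Fp L) a))) (imagUnit L) v₀ k
        then star (s (e₁.symm k).1) else s (e₁.symm k).1) ^ β (k, v₀) =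
      ∏ p : Fin 3, (if P p then s p ^ (β (e₁ (p, 0), v₀) : ℤ) else s p ^ (-(β (e₁ (p, 0), v₀) : ℤ))) := by
    rw [prod_fin_eq_prod_fin_three e₁]
    refine Finset.prod_congr rfl fun p _ => ?_
    rw [e₁_symm_fst_apply]
    by_cases hp : P p
    · rw [if_pos hp, if_pos hp, star_star, zpow_natCast]
    · rw [if_neg hp, if_neg hp, hsinv, zpow_neg, zpow_natCast, inv_pow]
  rw [hb, hc', ← Finset.prod_zpow, ← Finset.prod_mul_distrib, ← Finset.prod_mul_distrib]
  refine Finset.prod_congr rfl fun p _ => ?_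
  by_cases hp : P p
  · rw [if_pos hp, if_pos hp, if_pos hp, one_mul, ← zpow_add₀ (hs0 p)]
  · rw [if_neg hp, if_neg hp, if_neg hp, ← zpow_add₀ (hs0 p), ← zpow_add₀ (hs0 p)]
    congr 1
    ring

end Line

/-! ## §5 Node C∞'s theta side: the projected theta class of a Hermite box vector is an eigenvector of the torus at `w(ι)` -/

section Covariance

variable (L : Type) [Field L] [NumberField L] [IsCMField L] (ι : L →+* ℂ) (H : Matrix (Fin 3) (Fin 3) L) (T : GL (Fin 3) ℂ)
  (hT : (T : Matrix (Fin 3) (Fin 3) ℂ)ᴴ * H.map ι * (T : Matrix (Fin 3) (Fin 3) ℂ) = Literature.Geometry.ComplexHyperbolic.BallModel.J)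
  {n' : ℕ} (e₁ : Fin 3 × Fin 1 ≃ Fin n') (dV : Fin 3 → L) (hdV : ∀ i, IsCMField.complexConj L (dV i) = dV i)
  (hdV0 : ∀ i, dV i ≠ 0) (g : GL (Fin 3) L)
  (hg : ((g : Matrix (Fin 3) (Fin 3) L).map (cmConjRingHom L))ᵀ * H * (g : Matrix (Fin 3) (Fin 3) L) = Matrix.diagonal dV)
  (μ : Literature.NumberTheory.Automorphic.IdeleClassGroup L →ₜ* Circle) (hμ : IsConjugateSymplectic L μ) (a : (↥(maximalRealSubfield L))ˣ)
  (hρ : HasThetaMajorants fun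
      (p : ↥(UnitaryGroup.adelic (↥(maximalRealSubfield L)) L (IsCMField.complexConj L) 3 (Matrix.diagonal dV)) × ↥(UnitaryGroup.adelic (↥(maximalRealSubfield L)) L (IsCMField.complexConj L) 1 (JW (↥(maximalRealSubfield L)) L a))) (Φ : piSchwartzBruhat (↥(maximalRealSubfield L)) (Fin n')) =>
        pairRep (↥(maximalRealSubfield L)) L (IsCMField.complexConj L) 3 1 e₁ (Matrix.diagonal dV) (JW (↥(maximalRealSubfield L)) L a)
          (chiSplittingLine L e₁ dV hdV hdV0 (toHeckeCharacter L μ) (isUnitary_toHeckeCharacter L μ)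
            ((isOscillatorChar_toHeckeCharacter_iff μ).mpr hμ) (TW (↥(maximalRealSubfield L)) a)
            (isUnit_det_TW (↥(maximalRealSubfield L)) a) (JW (↥(maximalRealSubfield L)) L a) (JW_eq (↥(maximalRealSubfield L)) L a))
          p Φ)
  [CompactSpace (↥(UnitaryGroup.adelic (↥(maximalRealSubfield L)) L (IsCMField.complexConj L) 3 (Matrix.diagonal dV)) ⧸ (UnitaryGroup.toAdelic (↥(maximalRealSubfield L)) L (IsCMField.complexConj L) 3 (Matrix.diagonal dV)).range)] [MeasurableSpace (↥(UnitaryGroup.adelic (↥(maximalRealSubfield L)) L (IsCMField.complexConj L) 1 (JW (↥(maximalRealSubfield L)) L a)) ⧸ (UnitaryGroup.toAdelic (↥(maximalRealSubfield L)) L (IsCMField.complexConj L) 1 (JW (↥(maximalRealSubfield L)) L a)).range)] [BorelSpace (↥(UnitaryGroup.adelic (↥(maximalRealSubfield L)) L (IsCMField.complexConj L) 1 (JW (↥(maximalRealSubfield L)) L a)) ⧸ (UnitaryGroup.toAdelic (↥(maximalRealSubfield L)) L (IsCMField.complexConj L) 1 (JW (↥(maximalRealSubfield L)) L a)).range)]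 (μW : Measure (↥(UnitaryGroup.adelic (↥(maximalRealSubfield L)) L (IsCMField.complexConj L) 1 (JW (↥(maximalRealSubfield L)) L a)) ⧸ (UnitaryGroup.toAdelic (↥(maximalRealSubfield L)) L (IsCMField.complexConj L) 1 (JW (↥(maximalRealSubfield L)) L a)).range)) [IsFiniteMeasure μW]
  (f : C((↥(UnitaryGroup.adelic (↥(maximalRealSubfield L)) L (IsCMField.complexConj L) 1 (JW (↥(maximalRealSubfield L)) L a)) ⧸ (UnitaryGroup.toAdelic (↥(maximalRealSubfield L)) L (IsCMField.complexConj L) 1 (JW (↥(maximalRealSubfield L)) L a)).range), ℂ))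
  {μA : Measure (adelicGroupData (↥(maximalRealSubfield L)) L (IsCMField.complexConj L) 3 H).automorphicQuotient}
  [(adelicGroupData (↥(maximalRealSubfield L)) L (IsCMField.complexConj L) 3 H).IsAutomorphicMeasure μA]
  [CompactSpace (adelicGroupData (↥(maximalRealSubfield L)) L (IsCMField.complexConj L) 3 H).automorphicQuotient]
  (P : DiscreteAutomorphicRep (adelicGroupData (↥(maximalRealSubfield L)) L (IsCMField.complexConj L) 3 H) μA)

set_option maxHeartbeats 4000000 in
-- (the line telescope of ★ T2 and ★ FILE 1 is large; the rewrites are few)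
/-- **NODE C∞, THETA SIDE: THE PROJECTED THETA CLASS OF A HERMITE BOX VECTOR IS A TORUS EIGENVECTOR AT `w(ι)`.**  Let `v₀` be a real place of `L⁺` whose
complex place `w₀ = cmPlaceOver L v₀` is the place of `ι`, `τ = hμ.infinityType`-type exponents (`hτ`, `hodd`), `s : Fin 3 → ℂ` with `s̄ s = 1`, `β` a
Hermite multi-index and `Φ_f` a finite Schwartz–Bruhat vector.  Then there are `U ∈ U(2,1)` with `U = T⁻¹ · ι(g) · diag(embTwist ι ∘ s) · ι(g)⁻¹ · T` and
`k ∈ K_c` such that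
`(∏_p (s p)^{n p}) • pr_P [Θ̃_{E(h^V_β ⊗ Φ_f)}(f) ∘ ιA] = R(cmArchSection U) (R(k) (pr_P [Θ̃_{E(h^V_β ⊗ Φ_f)}(f) ∘ ιA]))`,
`n p = (τ_{w₀}+1)/2 + β(e₁(p,0),v₀)` on the positive sign class, `(τ_{w₀}+1)/2 − 1 − β(e₁(p,0),v₀)` on the negative one (§1–§4; ★ T2; ★ FILE 1 §1; ★ (P2) §4).
[cite: KonnoKonno2007, Thm. 5.4, Lem. 5.2] [cite: Liu2021, proof of Prop. 4.13 Case 1 (l. 2137–2141, p. 48); App. D Lem. D.2 (2)] [cite: BorelJacquet1979, §4.1, §4.6] -/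
theorem exists_U21_smul_starProjection_toLp_lineThetaLift_follandHermite (v₀ : {v : InfinitePlace (Fp L) // v.IsReal})
    (hv₀ : cmPlaceOver L v₀ = placeOf L ι (isComplex_mk_of_isCMField L ι))
    {τ : InfinitePlace L → ℤ} (hτ : (toHeckeCharacter L μ).HasUnitaryArchType τ 0) (hodd : ∀ w, Odd (τ w))
    (s : Fin 3 → ℂ) (hs : ∀ p, star (s p) * s p = 1)
    (β : (Fin n' × {v : InfinitePlace (Fp L) // v.IsReal}) →₀ ℕ) (Φf : FinSB (Fp L) (Fin n')) :
    ∃ (U : Literature.Geometry.ComplexHyperbolic.BallModel.U21) (k : (adelicGroupData (↥(maximalRealSubfield L)) L (IsCMField.complexConj L) 3 H).Adelic),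
      k ∈ cmCompactFactor L ι H T hT ∧
      Literature.Geometry.ComplexHyperbolic.BallModel.mat U =
        ((T⁻¹ * Matrix.GeneralLinearGroup.map ι g : GL (Fin 3) ℂ) : Matrix (Fin 3) (Fin 3) ℂ) * Matrix.diagonal (fun p => embTwist L ι (s p)) *
          (((T⁻¹ * Matrix.GeneralLinearGroup.map ι g)⁻¹ : GL (Fin 3) ℂ) : Matrix (Fin 3) (Fin 3) ℂ) ∧
      (∏ p : Fin 3, s p ^ (if 0 < signVec (cmPlaceOver L) (cmGramEntry L e₁ dV hdV (lineW L (TW (Fp L) a)) (complexConj_lineW L (TW (Fp L) a))) (imagUnit L) v₀ (e₁ (p, 0))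
        then (τ (cmPlaceOver L v₀).1 + 1) / 2 + β (e₁ (p, 0), v₀)
        else (τ (cmPlaceOver L v₀).1 + 1) / 2 - 1 - β (e₁ (p, 0), v₀))) •
        P.space.toSubmodule.starProjection
          (MemLp.toLp _ (memLp_toQuotFun_lineThetaLift L 3 H e₁ dV hdV hdV0 g hg μ hμ a hρ μW
            (piSchwartzBruhatEquiv (Fp L) (Fin n')
              (follandHermite (frameV L e₁ dV hdV hdV0 (lineW L (TW (Fp L) a)) (complexConj_lineW L (TW (Fp L) a))
                (lineW_ne_zero L (TW (Fp L) a) (isUnit_det_TW (Fp L) a))) β ⊗ₜ Φf)) f μA 2)) =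
      (adelicGroupData (↥(maximalRealSubfield L)) L (IsCMField.complexConj L) 3 H).rightRegular μA (cmArchSection L ι H T hT U)
        ((adelicGroupData (↥(maximalRealSubfield L)) L (IsCMField.complexConj L) 3 H).rightRegular μA k
          (P.space.toSubmodule.starProjection
            (MemLp.toLp _ (memLp_toQuotFun_lineThetaLift L 3 H e₁ dV hdV hdV0 g hg μ hμ a hρ μW
              (piSchwartzBruhatEquiv (Fp L) (Fin n')
                (follandHermite (frameV L e₁ dV hdV hdV0 (lineW L (TW (Fp L) a)) (complexConj_lineW L (TW (Fp L) a))
                  (lineW_ne_zero L (TW (Fp L) a) (isUnit_det_TW (Fp L) a))) β ⊗ₜ Φf)) f μA 2)))) := by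
  -- the torus element at `w₀`
  obtain ⟨u, hu⟩ := exists_archLocal_coe_eq_diagonal L dV (cmPlaceOver L v₀) s hs
  have hu' := hu
  -- the frame alignment at the place of `ι`
  obtain ⟨U, k, hk, hUk, hU⟩ := exists_cmArchSection_mul_eq_of_adelicSingle_placeOf L ι H T hT dV g hg (cmPlaceOver L v₀) hv₀ u
  refine ⟨U, k, hk, ?_, ?_⟩
  · rw [Literature.Geometry.ComplexHyperbolic.BallModel.mat, hU]
    have hmap : ((Matrix.GeneralLinearGroup.map (embTwist L ι)
        ((u : UnitaryGroup.archLocal L 3 (Matrix.diagonal dV) (cmPlaceOver L v₀)) : GL (Fin 3) ℂ) : GL (Fin 3) ℂ) : Matrix (Fin 3) (Fin 3) ℂ) =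
        Matrix.diagonal (fun p => embTwist L ι (s p)) := by
      show (((u : UnitaryGroup.archLocal L 3 (Matrix.diagonal dV) (cmPlaceOver L v₀)) : GL (Fin 3) ℂ) : Matrix (Fin 3) (Fin 3) ℂ).map (embTwist L ι) = _
      rw [hu, Matrix.diagonal_map (map_zero _)]
    simp only [Units.val_mul, mul_inv_rev, inv_inv, hmap, Matrix.mul_assoc]
  -- the Weil side: `ω((u at w₀), 1) E(h^V_β ⊗ Φ_f) = scalar • E(h^V_β ⊗ Φ_f)`
  set eV := frameV L e₁ dV hdV hdV0 (lineW L (TW (Fp L) a)) (complexConj_lineW L (TW (Fp L) a))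
    (lineW_ne_zero L (TW (Fp L) a) (isUnit_det_TW (Fp L) a)) with heV
  have hbox := carrierConjEquiv_frameD_sectionD_archKPlace_of_diagonal L e₁ dV hdV hdV0 (lineW L (TW (Fp L) a)) (complexConj_lineW L (TW (Fp L) a))
    (lineW_ne_zero L (TW (Fp L) a) (isUnit_det_TW (Fp L) a)) v₀ u s hu' β
  -- the one-place equivariance: `pr_P [Θ̃_{ω(y,1)Ψ}] = R(cmArchSection U · k) pr_P [Θ̃_Ψ]`
  have hE := starProjection_toLp_lineThetaLift_pairRep L H e₁ dV hdV hdV0 g hg μ hμ a hρ μW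
    (piSchwartzBruhatEquiv (Fp L) (Fin n') (follandHermite eV β ⊗ₜ Φf)) f P (cmArchSection L ι H T hT U * k)
  rw [hUk, map_mul] at hE
  by_cases hΦf : Φf = 0
  · -- trivial case `Φ_f = 0`: both sides are `0`
    subst hΦf
    rw [TensorProduct.tmul_zero, map_zero, ← zero_smul ℂ (0 : piSchwartzBruhat (Fp L) (Fin n')),
      toLp_lineThetaLift_smul_left L 3 H e₁ dV hdV hdV0 g hg μ hμ a hρ μW f μA, zero_smul, map_zero, smul_zero, map_zero, map_zero]
  have hne : piSchwartzBruhatEquiv (Fp L) (Fin n') (follandHermite eV 0 ⊗ₜ Φf) ≠ 0 :=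
    piSchwartzBruhatEquiv_tmul_ne_zero (gaussianV_ne_zero L e₁ dV hdV hdV0 _ _ _) hΦf
  have hT2 := pairRep_chiSplittingLine_adelicSingle_tmul_of_box L dV hdV hdV0 v₀ e₁ (isUnitary_toHeckeCharacter L μ)
    ((isOscillatorChar_toHeckeCharacter_iff μ).mpr hμ) hτ hodd (TW (Fp L) a) (isUnit_det_TW (Fp L) a) (JW (Fp L) L a) (JW_eq (Fp L) L a) u hbox Φf hne
  rw [toLp_lineThetaLift_congr L 3 H e₁ dV hdV hdV0 g hg μ hμ a hρ μW f μA hT2,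
    toLp_lineThetaLift_smul_left L 3 H e₁ dV hdV hdV0 g hg μ hμ a hρ μW f μA, map_smul,
    etaD_mul_vac_mul_prod_of_diagonal L e₁ dV hdV hdV0 a v₀ τ u s hs hu' β] at hE
  rw [hE]
  rfl

end Covariance

end Literature.NumberTheory.Automorphic.Liu2021.CinfThetaTorus

end
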